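import Literature.AlgebraicGeometry.ShimuraVarieties.UnitaryShimuraComplexGaloisDatum
import HarnessLib

/-!
# Shimura reciprocity of a form from the point action of its transported Galois automorphisms
# ([Milne 2005] Def. 12.8 (62) read on `V(ℂ)`, §13 p. 118; [Deligne 1971] Prop. 5.10 proof, last step)

Topic `AlgebraicGeometry/ShimuraVarieties`; namespace `Literature.AlgebraicGeometry.ShimuraVarieties.UnitaryCanonicalModel`
(sequel of `UnitaryShimuraComplexFibreGalois` / `UnitaryShimuraComplexGaloisDatum`).  THEOREMS ONLY (no definition, no
instance, no named fact, no `sorry`); net Literature debt 0.  Cell `hodgecm-mathlib` (D-0151), row I-6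
`descentToIntersection_printed` ([Deligne1971TravauxShimura] Prop. 5.10) `_holds` programme, piece **P5** of the lead's crew
map (A-p08 g2, 2026-08-28T06:25:50Z): the READ-BACK of reciprocity.

Setting: the hDel datum `(L, H, τ, T, hT, K₀)`, a complex record system `Sc` (`Sc.Mc : C5.SmallLevel K₀ ⥤ SchemeOver ℂ`,
`Sc.pts_K : Mc_K(ℂ) ≃ₜ Sh_K(ℂ)`), a base field `E` read through `ιE : E →+* ℂ` (resp. an intermediate field `E` of `ℂ/ℚ`) and an
`E`-form `(M₀, e₀ : M₀ ⊗_E ℂ ≅ Sc.Mc)` of the tower.  For `σ ∈ Aut(ℂ/E)` the tree's Galois automorphism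
`gal σ = 1 × Spec σ⁻¹` of `M₀,K ⊗_E ℂ` (`Motives/JacobianGaloisDescent`, [GortzWedhorn2020] (14.20.1)) transported along
`e₀,K` is an automorphism `λ_σ = e₀,K⁻¹ ≫ gal σ ≫ e₀,K` of the SCHEME `(Sc.Mc_K).left` covering `Spec σ⁻¹`.

* `smul_eq_of_specMap_comp_comp_conj_gal_eq` — the converse of `specMap_comp_comp_conj_gal_eq`
  (`UnitaryShimuraComplexGaloisDatum` §0): if `λ_σ` moves the point `p ↔ (Q, 1)` to `p′ ↔ (Q′, 1)` semilinearly,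
  `Spec σ ≫ p ≫ λ_σ = p′`, then `σ • Q = Q′` in `M₀,K(ℂ)` (`lift_comp_gal` + `eq_of_lift_eq` of
  `UnitaryShimuraComplexFibreGalois`; [Milne2005ShimuraVarieties] Prop. 13.1 p. 117 «the actions of `Aut(Ω/k)` on `V(Ω)`»).
* **`isCanonicalDescentOver_of_galTwist`** (any `ιE`) and **`isCanonicalDescentOver_of_gal_twist`** (the crew's currency:
  `E : IntermediateField ℚ ℂ`, `ιE = algebraMap ↥E ℂ`, `σ : ℂ ≃ₐ[↥E] ℂ`) — if for every level `K`, every `σ ∈ Aut_E(ℂ)` with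
  Artin correspondent `s`, every CM point `x₀` of a negative `L`-line, the diagonal twist `d` by `r_{x₀}(s)` and every `a`,
  the transported Galois automorphism acts on the special points by (62), `Spec σ ≫ Sc.pts⁻¹[x₀, aK] ≫ λ_σ = Sc.pts⁻¹[x₀, d·aK]`,
  THEN the form `(M₀, e₀)` satisfies Shimura reciprocity over `E`, `IsCanonicalDescentOver Sc ιE M₀ e₀` (its points read through
  `AlgPoints.baseChangeEquiv ιE` and `e₀`: `σ • P = P′`).  This is the step of [Deligne1971TravauxShimura] Prop. 5.10 in which
  the reciprocity law of the descended module `M_E` is read off the Galois action it was built from (Déf. 3.13: the special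
  points are algebraic with Galois action given by (3.9.1)).
* `gal_twist_of_isCanonicalDescentOver` — the converse read-out (A-p07's `ComplexRecordSystem.galoisTwistAut_transport`
  in the same currency), so that the two formulations are interchangeable for the lead.

HC_CM is proved only modulo the 7 printed citations until rung 0 closes; this file discharges none of them by itself.

## References
* [Milne2005ShimuraVarieties] J. S. Milne, *Introduction to Shimura varieties* (2005/2017): Def. 12.8 (62) p. 114, Prop. 13.1
  p. 117, §13 p. 118 L21–26.
* [Deligne1971TravauxShimura] P. Deligne, *Travaux de Shimura*, Sém. Bourbaki 389, LNM 244 (1971): Déf. 3.13 (p. 141),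
  Prop. 5.10 and Lemme 5.10.1 (pp. 157–158).
* [Deligne1979ShimuraVarieties] P. Deligne, *Variétés de Shimura* (1979), 2.2.4–2.2.5.
* [GortzWedhorn2020] U. Görtz, T. Wedhorn, *Algebraic Geometry I*, §(14.20).
-/

set_option autoImplicit false

noncomputable section

open Function MulAction Topology NumberField IsDedekindDomain CategoryTheory CategoryTheory.Limits Matrix
  AlgebraicGeometry
open scoped Matrix ComplexOrder
open Literature.AlgebraicGeometry.Motives
open Literature.NumberTheory.Automorphic Literature.NumberTheory.Automorphic.UnitaryGroup
open Literature.NumberTheory.Automorphic.Liu2021.AppendixC (C5.OpenCompactSubgroup C5.SmallLevel)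
open Literature.Geometry.ComplexHyperbolic Literature.Geometry.ComplexHyperbolic.BallModel
open Literature.NumberTheory.Automorphic.ShimuraDissection

namespace Literature.AlgebraicGeometry.ShimuraVarieties.UnitaryCanonicalModel

variable {L : Type} [Field L] [NumberField L] [IsCMField L] {H : Matrix (Fin 3) (Fin 3) L}
  {τ : L →+* ℂ} {T : GL (Fin 3) ℂ} {hT : formCongr (starRingEnd ℂ) T (H.map τ) = BallModel.J}
  {K₀ : C5.OpenCompactSubgroup ↥(finAdelic (↥(maximalRealSubfield L)) L (IsCMField.complexConj L) 3 H)}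

/-! ### §1. The point action of a transported Galois automorphism determines `σ • Q` -/

/-- **`σ • Q` is read off the transported Galois automorphism** (converse of `specMap_comp_comp_conj_gal_eq`;
[Milne2005ShimuraVarieties] Prop. 13.1 p. 117, «the actions of `Aut(Ω/k)` on `V(Ω)`»): let `X` be an `E`-scheme,
`σ ∈ Aut(ℂ/E)` with underlying ring automorphism `σ′`, `Q, Q′ ∈ X(ℂ)`, `eL : X ⊗_E ℂ ≅ Y` an isomorphism of schemes and
`p, p′ : Spec ℂ → Y` the points corresponding to `(Q, 1)`, `(Q′, 1)` under `eL`.  If the automorphism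
`eL⁻¹ ≫ (1 × Spec σ⁻¹) ≫ eL` of `Y` sends `p` to `p′` semilinearly, `Spec σ′ ≫ p ≫ eL⁻¹ ≫ gal σ ≫ eL = p′`, then `σ • Q = Q′`
(`lift_comp_gal`: `(Q,1) ≫ gal σ = Spec σ⁻¹ ≫ (σ • Q, 1)`, and `(·, 1)` is injective, `eq_of_lift_eq`).
[cite: Milne2005ShimuraVarieties, Prop. 13.1 p. 117; §13 p. 118 L21–26] -/
theorem smul_eq_of_specMap_comp_comp_conj_gal_eq {E : Type} [Field E] {ιE : E →+* ℂ} (X : SchemeOver E) {Y : Scheme}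
    (σ : letI : Algebra E ℂ := ιE.toAlgebra; ℂ ≃ₐ[E] ℂ) (σ' : ℂ ≃+* ℂ)
    (hσ' : letI : Algebra E ℂ := ιE.toAlgebra
      AbelianVariety.specAut ℂ σ⁻¹ = Spec.map (CommRingCat.ofHom (σ'.symm : ℂ →+* ℂ)))
    (Q Q' : letI : Algebra E ℂ := ιE.toAlgebra; ComplexPoints X)
    (eL : letI : Algebra E ℂ := ιE.toAlgebra; GaloisDescent.bc ℂ X ≅ Y) (p p' : Spec (.of ℂ) ⟶ Y)
    (hp : letI : Algebra E ℂ := ιE.toAlgebra; p ≫ eL.inv = (AlgPoints.baseChangeEquiv ιE X Q).left)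
    (hp' : letI : Algebra E ℂ := ιE.toAlgebra; p' ≫ eL.inv = (AlgPoints.baseChangeEquiv ιE X Q').left)
    (h : letI : Algebra E ℂ := ιE.toAlgebra
      Spec.map (CommRingCat.ofHom (σ' : ℂ →+* ℂ)) ≫ p ≫ eL.inv ≫ GaloisDescent.gal ℂ X σ ≫ eL.hom = p') :
    letI : Algebra E ℂ := ιE.toAlgebra
    σ • Q = Q' := by
  letI : Algebra E ℂ := ιE.toAlgebra
  -- the points `p ≫ eL⁻¹`, `p' ≫ eL⁻¹` of `X ⊗_E ℂ` in the `pullback.lift` spelling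
  have hpL : p ≫ eL.inv = pullback.lift Q.toSpecHom (𝟙 (Spec (.of ℂ))) (toSpecHom_comp_hom_eq (τ := ιE) X Q) := by
    rw [lift_eq_baseChangeEquiv_left]; exact hp
  have hpL' : p' ≫ eL.inv =
      pullback.lift Q'.toSpecHom (𝟙 (Spec (.of ℂ))) (toSpecHom_comp_hom_eq (τ := ιE) X Q') := by
    rw [lift_eq_baseChangeEquiv_left]; exact hp'
  -- `(Q, 1) ≫ gal σ = Spec σ⁻¹ ≫ (σ • Q, 1)`
  have h3 := lift_comp_gal (τ := ιE) X σ Q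
  rw [← hpL] at h3
  have hS : Spec.map (CommRingCat.ofHom (σ' : ℂ →+* ℂ)) ≫ AbelianVariety.specAut ℂ σ⁻¹ = 𝟙 _ := by
    rw [hσ', specMap_ringEquiv_comp_symm]
  have h5 : Spec.map (CommRingCat.ofHom (σ' : ℂ →+* ℂ)) ≫ p ≫ eL.inv ≫ GaloisDescent.gal ℂ X σ =
      pullback.lift (σ • Q).toSpecHom (𝟙 (Spec (.of ℂ))) (toSpecHom_comp_hom_eq (τ := ιE) X (σ • Q)) := by
    have h' := congrArg (fun f => Spec.map (CommRingCat.ofHom (σ' : ℂ →+* ℂ)) ≫ f) h3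
    simp only [Category.assoc] at h'
    rw [reassoc_of% hS] at h'
    exact h'
  -- strip `eL` off the hypothesis
  have h4 : Spec.map (CommRingCat.ofHom (σ' : ℂ →+* ℂ)) ≫ p ≫ eL.inv ≫ GaloisDescent.gal ℂ X σ = p' ≫ eL.inv := by
    rw [← h]
    simp only [Category.assoc, Iso.hom_inv_id, Category.comp_id]
  apply eq_of_lift_eq (τ := ιE) X
  rw [← h5, h4, hpL']

namespace ComplexRecordSystem

/-! ### §2. Reciprocity of a form from the point action of its transported Galois automorphisms (any base `ιE`) -/

/-- **Shimura reciprocity of an `E`-form read off its transported Galois automorphisms** (generic base `ιE : E → ℂ`):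
if for every level `K`, every `σ ∈ Aut_E(ℂ)` with Artin correspondent `s`, every CM point `x₀` of a negative `L`-line, the
diagonal twist `d` by `r_{x₀}(s)` and every `a`, the automorphism `e₀,K⁻¹ ≫ (1 × Spec σ⁻¹) ≫ e₀,K` of `(Sc.Mc_K).left` satisfies
`Spec σ ≫ Sc.pts⁻¹[x₀, aK] ≫ (e₀,K⁻¹ ≫ gal σ ≫ e₀,K) = Sc.pts⁻¹[x₀, d·aK]`, then `(M₀, e₀)` satisfies (62) at the diagonal special
pairs over `E`: `IsCanonicalDescentOver Sc ιE M₀ e₀`.  (The last step of [Deligne1971TravauxShimura] Prop. 5.10: the reciprocity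
law of the descended module is the point action of the Galois datum it was descended from.)
[cite: Deligne1971TravauxShimura, Prop. 5.10 (p. 157) with Déf. 3.13 (p. 141)] [cite: Milne2005ShimuraVarieties, Def. 12.8 (62) p. 114; §13 p. 118 L21–26] -/
theorem isCanonicalDescentOver_of_galTwist (Sc : ComplexRecordSystem L H τ T hT K₀)
    {E : Type} [Field E] (ιE : E →+* ℂ) (M₀ : C5.SmallLevel K₀ ⥤ SchemeOver E)
    (e₀ : (M₀ ⋙ Motives.baseChangeHom ιE) ≅ Sc.Mc)
    (hrec : letI : Algebra E ℂ := ιE.toAlgebra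
      ∀ (K : C5.SmallLevel K₀) (σ : ℂ ≃ₐ[E] ℂ) (s : (FiniteAdeleRing (𝓞 L) L)ˣ),
        IsArtinCorrespondent L τ s σ.toRingEquiv →
        ∀ (v₃ : Fin 3 → L) (x₀ : Ball), IsLinePoint L τ T v₃ x₀ →
          ∀ d : finAdelic (↥(maximalRealSubfield L)) L (IsCMField.complexConj L) 3 H,
            IsDiagTwist L H v₃ (recipFactor L s) d →
            ∀ a : finAdelic (↥(maximalRealSubfield L)) L (IsCMField.complexConj L) 3 H,
              Spec.map (CommRingCat.ofHom (σ.toRingEquiv : ℂ →+* ℂ)) ≫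
                  ((Sc.pts K).symm (ShimuraSet.mk L H τ T hT K.1.1 x₀ a)).toSpecHom ≫
                    (((e₀.inv.app K).left : (Sc.Mc.obj K).left ⟶ GaloisDescent.bc ℂ (M₀.obj K)) ≫
                      GaloisDescent.gal ℂ (M₀.obj K) σ ≫
                        ((e₀.hom.app K).left : GaloisDescent.bc ℂ (M₀.obj K) ⟶ (Sc.Mc.obj K).left)) =
                ((Sc.pts K).symm (ShimuraSet.mk L H τ T hT K.1.1 x₀ (d * a))).toSpecHom) :
    IsCanonicalDescentOver Sc ιE M₀ e₀ := by
  letI : Algebra E ℂ := ιE.toAlgebra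
  intro K σ s hs v₃ x hx d hd a
  have hσ' : ((σ⁻¹ : ℂ ≃ₐ[E] ℂ) : ℂ →+* ℂ) = (σ.toRingEquiv.symm : ℂ →+* ℂ) := RingHom.ext fun _ => rfl
  have hσspec : AbelianVariety.specAut ℂ σ⁻¹ = Spec.map (CommRingCat.ofHom (σ.toRingEquiv.symm : ℂ →+* ℂ)) := by
    dsimp only [AbelianVariety.specAut]
    rw [hσ']
  -- the underlying scheme isomorphism of `e₀,K`
  let eL : GaloisDescent.bc ℂ (M₀.obj K) ≅ (Sc.Mc.obj K).left := (Over.forget _).mapIso (e₀.app K)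
  -- the special points of `Sc.Mc_K(ℂ)` read in `M₀,K(ℂ)` through `e₀,K`
  have h1 : ∀ b : finAdelic (↥(maximalRealSubfield L)) L (IsCMField.complexConj L) 3 H,
      ((Sc.pts K).symm (ShimuraSet.mk L H τ T hT K.1.1 x b)).toSpecHom ≫ eL.inv =
        (AlgPoints.baseChangeEquiv ιE (M₀.obj K) ((AlgPoints.baseChangeEquiv ιE (M₀.obj K)).symm
          (AlgPoints.map (e₀.inv.app K) ((Sc.pts K).symm (ShimuraSet.mk L H τ T hT K.1.1 x b))))).left := by
    intro b
    rw [Equiv.apply_symm_apply]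
    rfl
  exact smul_eq_of_specMap_comp_comp_conj_gal_eq (ιE := ιE) (M₀.obj K) σ σ.toRingEquiv hσspec _ _ eL _ _
    (h1 a) (h1 (d * a)) (hrec K σ s hs v₃ x hx d hd a)

/-! ### §3. The crew's currency: `E` an intermediate field of `ℂ/ℚ`, `σ : ℂ ≃ₐ[↥E] ℂ` -/

/-- **P5 of the I-6 crew map — reciprocity over `E ⊆ ℂ` from the point action of the transported `gal`**: for an
intermediate field `E` of `ℂ/ℚ` and an `E`-form `(M₀, e₀ : M₀ ⊗_E ℂ ≅ Sc.Mc)`, IF for all `K`, `σ : ℂ ≃ₐ[↥E] ℂ` with Artin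
correspondent `s`, line points `x₀`, twists `d` by `r_{x₀}(s)` and all `a`
`Spec σ ≫ Sc.pts⁻¹[x₀, aK] ≫ ((e₀.app K).inv.left ≫ gal ℂ (M₀.obj K) σ ≫ (e₀.app K).hom.left) = Sc.pts⁻¹[x₀, d·aK]`,
THEN `IsCanonicalDescentOver Sc (algebraMap ↥E ℂ) M₀ e₀` ([Milne2005ShimuraVarieties] Def. 12.8 (62) over the larger field `E`,
Rem. 12.9).  The canonical `Algebra ↥E ℂ` instance and the predicate's `(algebraMap ↥E ℂ).toAlgebra` agree (structure eta).
[cite: Deligne1971TravauxShimura, Prop. 5.10 (p. 157) with Déf. 3.13 (p. 141)] [cite: Milne2005ShimuraVarieties, Def. 12.8 (62) p. 114 and Rem. 12.9 p. 115] -/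
theorem isCanonicalDescentOver_of_gal_twist (Sc : ComplexRecordSystem L H τ T hT K₀) (E : IntermediateField ℚ ℂ)
    (M₀ : C5.SmallLevel K₀ ⥤ SchemeOver ↥E) (e₀ : (M₀ ⋙ Motives.baseChange ↥E ℂ) ≅ Sc.Mc)
    (hrec : ∀ (K : C5.SmallLevel K₀) (σ : ℂ ≃ₐ[↥E] ℂ) (s : (FiniteAdeleRing (𝓞 L) L)ˣ),
      IsArtinCorrespondent L τ s σ.toRingEquiv →
      ∀ (v₃ : Fin 3 → L) (x₀ : Ball), IsLinePoint L τ T v₃ x₀ →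
        ∀ d : finAdelic (↥(maximalRealSubfield L)) L (IsCMField.complexConj L) 3 H,
          IsDiagTwist L H v₃ (recipFactor L s) d →
          ∀ a : finAdelic (↥(maximalRealSubfield L)) L (IsCMField.complexConj L) 3 H,
            Spec.map (CommRingCat.ofHom ((σ : ℂ ≃+* ℂ) : ℂ →+* ℂ)) ≫
                ((Sc.pts K).symm (ShimuraSet.mk L H τ T hT K.1.1 x₀ a)).left ≫
                  ((e₀.app K).inv.left ≫ GaloisDescent.gal ℂ (M₀.obj K) σ ≫ (e₀.app K).hom.left) =
              ((Sc.pts K).symm (ShimuraSet.mk L H τ T hT K.1.1 x₀ (d * a))).left) :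
    IsCanonicalDescentOver Sc (algebraMap ↥E ℂ) M₀ e₀ := by
  refine isCanonicalDescentOver_of_galTwist Sc (algebraMap ↥E ℂ) M₀ e₀ ?_
  intro K σ s hs v₃ x₀ hx₀ d hd a
  exact hrec K σ s hs v₃ x₀ hx₀ d hd a

/-- **The converse read-out in the same currency** (A-p07's `galoisTwistAut_transport`): an `E`-form with reciprocity
over `E ⊆ ℂ` has transported Galois automorphisms acting on the special points by (62).
[cite: Deligne1979ShimuraVarieties, 2.2.4–2.2.5] [cite: Milne2005ShimuraVarieties, Def. 12.8 (62) p. 114; §13 p. 118 L21–26] -/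
theorem gal_twist_of_isCanonicalDescentOver (Sc : ComplexRecordSystem L H τ T hT K₀) (E : IntermediateField ℚ ℂ)
    (M₀ : C5.SmallLevel K₀ ⥤ SchemeOver ↥E) (e₀ : (M₀ ⋙ Motives.baseChange ↥E ℂ) ≅ Sc.Mc)
    (hM : IsCanonicalDescentOver Sc (algebraMap ↥E ℂ) M₀ e₀)
    (K : C5.SmallLevel K₀) (σ : ℂ ≃ₐ[↥E] ℂ) {s : (FiniteAdeleRing (𝓞 L) L)ˣ}
    (hs : IsArtinCorrespondent L τ s σ.toRingEquiv)
    {v₃ : Fin 3 → L} {x₀ : Ball} (hx₀ : IsLinePoint L τ T v₃ x₀)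
    {d : finAdelic (↥(maximalRealSubfield L)) L (IsCMField.complexConj L) 3 H}
    (hd : IsDiagTwist L H v₃ (recipFactor L s) d)
    (a : finAdelic (↥(maximalRealSubfield L)) L (IsCMField.complexConj L) 3 H) :
    Spec.map (CommRingCat.ofHom ((σ : ℂ ≃+* ℂ) : ℂ →+* ℂ)) ≫
        ((Sc.pts K).symm (ShimuraSet.mk L H τ T hT K.1.1 x₀ a)).left ≫
          ((e₀.app K).inv.left ≫ GaloisDescent.gal ℂ (M₀.obj K) σ ≫ (e₀.app K).hom.left) =
      ((Sc.pts K).symm (ShimuraSet.mk L H τ T hT K.1.1 x₀ (d * a))).left :=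
  (galoisTwistAut_transport Sc (algebraMap ↥E ℂ) M₀ e₀ hM K σ hs hx₀ hd).2 a

end ComplexRecordSystem

end Literature.AlgebraicGeometry.ShimuraVarieties.UnitaryCanonicalModel

end
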